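import Summits.QuantumFields.YangMills.Theorems.BalabanUVNodesN09AtRecord9
import Literature.MathematicalPhysics.QuantumFieldTheory.Balaban1983to89.Node00.CarriersY
import Literature.MathematicalPhysics.QuantumFieldTheory.Balaban1983to89.B9PinCarriersNonVacuity
import Literature.MathematicalPhysics.QuantumFieldTheory.Balaban1983to89.Node00.N03Record

/-!
# BalabanUVNodes ∕ N06 ([B9], `Dag.B9_main`) AT THE STAGE-3′(Y) RECORD `Node00.IsRecordOfRecord₉CB10Y` — the (W2) closer set of the K2 stub
# `YMDAG.UVSplit.S_N06 Rec := AtRecord Rec Dag.B9_main` (`BalabanUVNodesClustersCore` :183) over node00-def g29's cumulative record predicate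
# (`Node00/CarriersY.lean` p425205): READINGS · CLOSERS BY NAME · GUARDS (the ∀-form over ₉CB10Y is NOT a discharge target: the kernel says why)

Track A of `YM-PLAN.md` (cell `pub-ymgap`, HUMAN RULING D-0062), node **N06** = [Balaban1985BackgroundPropagators] Thms 3.1–3.15; typed by the free -b hand
`pub-ymgap-dag-n22-b` (generation 2) under dag-lead's REBALANCE №44 (owner-less (W2) module; pattern = `BalabanUVNodesN09AtRecord9` ∕ `…N15AtSpineCarriers` ∕
`…N20AtSpineCarriers`).  Owners of record of the CONTENT, consumed BY NAME only, nothing restated: node00-def g29 (`Node00.Y9OfRecord`, `OpsY`,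
`IsRecordOfRecord₉CB10Y`, `leaf_b9_iff_of_isRecordOfRecord₉CB10Y`, `b9_main_of_isRecordOfRecord₉CB10Y_of_slots`, `isRecordOfRecord₉C_of_isRecordOfRecord₉CB10Y`,
`exists_world_isRecordOfRecord₉CB10Y`), def-Y = dag-n06-a (`B9PinCarriersKLevelV1.b9LeafX_carriersY`, `B9PinCarriersNonVacuity.exists_ops_b9LeafX`), node00-def ∕
dag-n03 (`Node00.b6BlockParam_D6OfRecord` — N03 DISCHARGED, R443), dag-n09-a (`N09AtRecord9.guards_of_isRecordOfRecord₉C`).  Kernel bookkeeping: 0 `def`,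
0 `sorry`, standard axioms.  COUNT-NEUTRAL; `--supports` item `StabilityBAtRecord` (stmt-QuantumFields-19183).

THE STUB.  `S_N06 Rec := ∀ F D w, Rec F D w → ∀ P, Dag.B9_main (leavesP w P)`, `Dag.B9_main ℓ := ℓ.b4 → ℓ.b5 → ℓ.b6 → ℓ.b7 → ℓ.b9`.  AT A ₉CB10Y RECORD the
in-edges `b4 b5 b6 b7` HOLD (the ₉C guards), and the `b9` leaf IS def-Y's extended leaf `B9LeafX (Y9OfRecord N θ₃ M⋆ ops)` at the [B9] bundle of record for
the PRESENTING package `(θ, h, M⋆, ops)` — where the OPERATOR LAYER `ops : OpsY N θ₃ M⋆` (Bałaban's propagators `G′(U), G(U), …`, their random-walk expansions,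
positivity ∕ analyticity predicates; def-Y's `OperatorLayerY`, 23 fields) is RESIDUAL DATA, existentially hidden in the predicate with NO LAW ON IT (g29, verbatim:
*«for SOME floor `Mstar` and SOME operator layer `ops` (residual data, quantified with the record's parameters; no law on them is assumed)»*).

WHAT THIS MODULE IS.
* §1 (W2) READINGS: `s_N06_iff₉CB10Y` (`Iff.rfl`); `guards_of_isRecordOfRecord₉CB10Y` (`b4 ∧ b5 ∧ b6 ∧ b7`); `b9_main_iff_leaf_of_isRecordOfRecord₉CB10Y`
  (N06 at a record's run ⇔ the bare leaf `b9`); `b9_main_iff_leafX_of_isRecordOfRecord₉CB10Y` (⇔ `B9LeafX` at the bundle of record of the presenting package);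
  `s_N06_iff_leaf₉CB10Y`.
* §2 (W2) CLOSERS BY NAME: **`s_N06_record₉CB10Y_of_leafSlot`** (package form, g29's `_of_slots`); **`s_N06_record₉CB10Y_of_bundleSlot`** (bundle form: the leaf at
  EVERY `(θ₃, M⋆, ops)`, `θ₃` Stage-1-admissible); `s_N06_of_refines₉CB10Y` (every `Rec` refining ₉CB10Y); and the bundle-level knit
  **`b9LeafX_Y9OfRecord_of_obligations`** = def-Y's `b9LeafX_carriersY` at the record's `SU(N) ⊂ M_N(ℂ)` data with the [B6] block DISCHARGED BY NAME
  (`Node00.b6BlockParam_D6OfRecord`, N03's theorem of record): what remains displayed is EXACTLY the operator layer's obligations (the eight `U = 1` comparisons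
  against NODE 00's readings, the two null readings, the residual entries, the Sect.-B step, the gauge reduction, the sixteen whole-statement leaves).
* §3 (W2) GUARDS — THE HONESTY OF THE MODULE:
  - **`b9LeafX_of_s_N06_record₉CB10Y`** ∕ **`not_s_N06_record₉CB10Y_of_badOps`**: the ∀-form `S_N06 (₉CB10Y)` FORCES the leaf at EVERY operator layer over every
    admissible Stage-9 parameter with provisos (and window `γ > 0`) — including layers carrying data that violate print; ONE such layer refutes the ∀-form.  So
    the ∀-form over ₉CB10Y is NOT an N06 closer TARGET (plan rev-1: socket form, as at ₉C); the operator layer (XL) is the next pin, unassigned.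
  - **`exists_junkOps_b9LeafX_Y9OfRecord`** ∕ **`exists_record₉CB10Y_b9_main_junk`**: conversely the ZERO operator layer (def-Y's A5 certificate
    `exists_ops_b9LeafX`) closes the leaf at the bundle of record, so at the junk-presented records N06 HOLDS BY `exact` — INHABITED, NON-VACUOUS, and
    CONTENT-FREE: the vacuity source of any «N06 at ₉CB10Y» sentence, LOCATED.
  - `not_s_N06_of_admits` (R422 at node level), `s_N06_of_empty` (vacuity over an empty predicate).
  A1 SENTENCE: INHABITED-AT-₉C is NODE 00 ∕ W00's K0 item `Record9Inhabited` (chair R447) — NOT claimed here; every inhabitation statement below is RELATIVE to an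
  admissible `Stage9Params` with its `Provisos` (`Node00.exists_world_isRecordOfRecord₉CB10Y`).
ref-A's clause, VERBATIM (g29 header, R433 ∕ pub-ymgap INBOX l.11134 (K2)): *«the leaf is STILL CLOSABLE BY A JUNK OPERATOR LAYER (zero kernels meet every
printed bound …) until that layer is an object of record — so N06 is NOT bookable over this predicate in ∀-form; the value of the pin is «geometry ∕ index ∕
backgrounds of [B9] discharged by name at the record», one stage, as ₇'s `rep`.»*

HONEST FRAMING.  [B9]'s Theorems 3.1–3.15 are NOT proved here or anywhere in the tree for Bałaban's operators; `S_N06` is closed ONLY from displayed slots; N06 is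
NOT discharged (0∕1 at every record; typed 28∕28, discharged 5∕27 untouched by this file); one finite four-torus programme at fixed `ε` — NOT ℝ⁴, NOT infinite
volume, NOT OS, NOT a mass gap, NOT Clay.  Restate-immune (no `def`).
-/

noncomputable section

namespace Summit.QuantumFields.YangMills.BalabanUVNodes.N06AtRecord9CB10Y

open Literature.MathematicalPhysics.QuantumFieldTheory.Balaban1983to89
open Literature.MathematicalPhysics.QuantumFieldTheory.Balaban1983to89.T4Continuum (T4Family FiniteEpsData)
open Literature.MathematicalPhysics.QuantumFieldTheory.Balaban1983to89.DagBinding (WorldP leavesP B9LeafX B6BlockParam)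
open Literature.MathematicalPhysics.QuantumFieldTheory.Balaban1983to89.Node00
open Literature.MathematicalPhysics.QuantumFieldTheory.Balaban1983to89.B9PinMembersKLevelV1 (MemberY geo9Y bg9Y)
open Literature.MathematicalPhysics.QuantumFieldTheory.Balaban1983to89.B9PinGeometryKLevelV1 (dOmegaY OmKY inΛY unitDistY InCubeY c35Y)
open Literature.MathematicalPhysics.QuantumFieldTheory.Balaban1983to89.B7Prop2SpecialUnitary (specialUnitaryUnits)
open YMDAG.UVSplit (RecordPred Datum AtRecord S_N06)
open Summit.QuantumFields.YangMills.BalabanUVNodes.N09AtRecord9 (guards_of_isRecordOfRecord₉C)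
open scoped Matrix.Norms.L2Operator

variable {N : ℕ} [NeZero N]

/-! ## §1 (W2) readings -/

/-- **What `S_N06` says over the Stage-3′(Y) record** (`Iff.rfl`): at every ₉CB10Y record and every run, `Dag.B9_main`.
[cite: Balaban1985BackgroundPropagators, Thms 3.1–3.15 pp.397–432 (the node's shape `Dag.B9_main`, bookkeeping)] -/
theorem s_N06_iff₉CB10Y :
    S_N06 (fun F D w => IsRecordOfRecord₉CB10Y F N D w) ↔
      ∀ (F : T4Family) (D : Datum F N) (w : WorldP), IsRecordOfRecord₉CB10Y F N D w → ∀ P : B12.RunParams, Dag.B9_main (leavesP w P) :=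
  Iff.rfl

section Record

variable {F : T4Family} {D : FiniteEpsData F (Node00.SU N)} {w : WorldP}

/-- **In-edge guards at every run of a ₉CB10Y record**: `b4 b5 b6 b7` HOLD (N01 ∕ N02 ∕ N03 ∕ N04 are theorems at the record; transferred from ₉C by g29's
refinement `isRecordOfRecord₉C_of_isRecordOfRecord₉CB10Y`, same datum, same world). [cite: Balaban1985Averaging, Props. 1–10 pp.26–50 (bookkeeping, transferred)] -/
theorem guards_of_isRecordOfRecord₉CB10Y (h : IsRecordOfRecord₉CB10Y F N D w) (P : B12.RunParams) :
    (leavesP w P).b4 ∧ (leavesP w P).b5 ∧ (leavesP w P).b6 ∧ (leavesP w P).b7 :=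
  guards_of_isRecordOfRecord₉C (isRecordOfRecord₉C_of_isRecordOfRecord₉CB10Y h) P

/-- **At a ₉CB10Y record N06 IS THE BARE LEAF `b9`** (the four discharged in-edges drop out). [cite: Balaban1985BackgroundPropagators, Thms 3.1–3.15 pp.397–432 (bookkeeping)] -/
theorem b9_main_iff_leaf_of_isRecordOfRecord₉CB10Y (h : IsRecordOfRecord₉CB10Y F N D w) (P : B12.RunParams) :
    Dag.B9_main (leavesP w P) ↔ (leavesP w P).b9 := by
  obtain ⟨h4, h5, h6, h7⟩ := guards_of_isRecordOfRecord₉CB10Y h P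
  exact ⟨fun hm => hm h4 h5 h6 h7, fun hb _ _ _ _ => hb⟩

/-- **At a ₉CB10Y record N06 IS def-Y's EXTENDED LEAF AT THE [B9] BUNDLE OF RECORD** of the presenting package: for the record's Stage-3 dictionary `θ₃`, floor `M⋆`
and operator layer `ops`, `Dag.B9_main (leavesP w P) ↔ B9LeafX (Y9OfRecord N θ₃ M⋆ ops)` at every run (g29's `leaf_b9_iff_of_isRecordOfRecord₉CB10Y` + the guards).
[cite: Balaban1985BackgroundPropagators, Thms 3.1–3.15 pp.397–432] -/
theorem b9_main_iff_leafX_of_isRecordOfRecord₉CB10Y (h : IsRecordOfRecord₉CB10Y F N D w) :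
    ∃ (θ₃ : Stage3Params) (Mstar : ℕ) (ops : OpsY N θ₃ Mstar), θ₃.toStage1Params.Admissible ∧ w.L = (θ₃.L : ℝ) ∧
      ∀ P : B12.RunParams, Dag.B9_main (leavesP w P) ↔ B9LeafX (Y9OfRecord N θ₃ Mstar ops) := by
  obtain ⟨θ₃, Mstar, ops, hadm, hL, hiff⟩ := leaf_b9_iff_of_isRecordOfRecord₉CB10Y h
  exact ⟨θ₃, Mstar, ops, hadm, hL, fun P => (b9_main_iff_leaf_of_isRecordOfRecord₉CB10Y h P).trans (hiff P)⟩

end Record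

/-- **`S_N06` over ₉CB10Y IS «the leaf `b9` at every run of every record»**. [cite: Balaban1985BackgroundPropagators, Thms 3.1–3.15 pp.397–432 (bookkeeping)] -/
theorem s_N06_iff_leaf₉CB10Y :
    S_N06 (fun F D w => IsRecordOfRecord₉CB10Y F N D w) ↔
      ∀ (F : T4Family) (D : Datum F N) (w : WorldP), IsRecordOfRecord₉CB10Y F N D w → ∀ P : B12.RunParams, (leavesP w P).b9 :=
  ⟨fun h F D w hR P => (b9_main_iff_leaf_of_isRecordOfRecord₉CB10Y hR P).1 (h F D w hR P),
    fun h F D w hR P => (b9_main_iff_leaf_of_isRecordOfRecord₉CB10Y hR P).2 (h F D w hR P)⟩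

/-! ## §2 (W2) closers BY NAME -/

/-- **`S_N06 (₉CB10Y)` FROM THE LEAF SLOT, PACKAGE FORM**: if for every record and every package `(θ, h, M⋆, ops)` PRESENTING it the extended leaf holds at the
bundle of record, then `S_N06` over ₉CB10Y (g29's `b9_main_of_isRecordOfRecord₉CB10Y_of_slots` at every record; in-edges unused).  The slot quantifies over the
HIDDEN operator layer — honest, and §3 says what that costs. [cite: Balaban1985BackgroundPropagators, Thms 3.1–3.15 pp.397–432 (bookkeeping)] -/
theorem s_N06_record₉CB10Y_of_leafSlot
    (hslot : ∀ (F : T4Family) (D : Datum F N) (w : WorldP), IsRecordOfRecord₉CB10Y F N D w →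
      ∀ (θ : Stage9Params F N) (hP : θ.Provisos) (Mstar : ℕ) (ops : OpsY N θ.toStage3Params Mstar), θ.Admissible →
        D = datumOfRecord₉ F N θ hP →
        (∀ P, w.up P = upOfRecord₅C F N (((θ.toStage5 F N).pinB10 F N).pinY F N (Y9OfRecord N θ.toStage3Params Mstar ops)) P) →
          B9LeafX (Y9OfRecord N θ.toStage3Params Mstar ops)) :
    S_N06 (fun F D w => IsRecordOfRecord₉CB10Y F N D w) :=
  fun F D w h P => b9_main_of_isRecordOfRecord₉CB10Y_of_slots h (hslot F D w h) P

/-- **`S_N06 (₉CB10Y)` FROM THE LEAF SLOT, BUNDLE FORM**: if the extended leaf holds at the [B9] bundle of record `Y9OfRecord N θ₃ M⋆ ops` for EVERY Stage-3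
dictionary with admissible Stage-1 part, EVERY floor and EVERY operator layer, then `S_N06` over ₉CB10Y.  (This is what a proof of the ∀-form must supply — §3
`b9LeafX_of_s_N06_record₉CB10Y` is the converse.) [cite: Balaban1985BackgroundPropagators, Thms 3.1–3.15 pp.397–432 (bookkeeping)] -/
theorem s_N06_record₉CB10Y_of_bundleSlot
    (hslot : ∀ (θ₃ : Stage3Params), θ₃.toStage1Params.Admissible → ∀ (Mstar : ℕ) (ops : OpsY N θ₃ Mstar), B9LeafX (Y9OfRecord N θ₃ Mstar ops)) :
    S_N06 (fun F D w => IsRecordOfRecord₉CB10Y F N D w) := by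
  intro F D w h P
  obtain ⟨θ₃, Mstar, ops, hadm, -, hiff⟩ := b9_main_iff_leafX_of_isRecordOfRecord₉CB10Y h
  exact (hiff P).2 (hslot θ₃ hadm Mstar ops)

/-- **`S_N06 Rec` FOR EVERY RECORD PREDICATE REFINING ₉CB10Y**, from the bundle slot (refinement-generic). [cite: Balaban1985BackgroundPropagators, Thms 3.1–3.15 pp.397–432 (bookkeeping)] -/
theorem s_N06_of_refines₉CB10Y (Rec : RecordPred N)
    (href : ∀ (F : T4Family) (D : Datum F N) (w : WorldP), Rec F D w → IsRecordOfRecord₉CB10Y F N D w)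
    (hslot : ∀ (θ₃ : Stage3Params), θ₃.toStage1Params.Admissible → ∀ (Mstar : ℕ) (ops : OpsY N θ₃ Mstar), B9LeafX (Y9OfRecord N θ₃ Mstar ops)) :
    S_N06 Rec :=
  fun F D w hR P => s_N06_record₉CB10Y_of_bundleSlot hslot F D w (href F D w hR) P

/-- **THE KNIT AT THE BUNDLE OF RECORD, [B6] BLOCK DISCHARGED — WHAT REMAINS IS THE OPERATOR LAYER'S OBLIGATIONS, EXACTLY**: def-Y's `b9LeafX_carriersY` read at
the record's `M_N(ℂ) ⊃ SU(N)` data and Stage-3 dictionary `θ₃`, with the [B6] block at NODE 00's tower block of record supplied BY NAME by N03's theorem of record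
`Node00.b6BlockParam_D6OfRecord θ₃` (`D6OfRecord θ₃` IS that tower block, `rfl`).  Displayed: the eight `U = 1` comparisons of `ops` against NODE 00's readings
`GpU ∕ CinvU ∕ GU`, the two null readings, the residual entries, the Sect.-B step, the gauge reduction and the sixteen whole-statement leaves of [B9] — the operator
layer's obligations and NOTHING ELSE; a genuine (XL) layer meeting them gives `S_N06` by `s_N06_record₉CB10Y_of_bundleSlot`. [cite: Balaban1985BackgroundPropagators, Thms 3.1–3.15 pp.397–432; Cor. 3.5 proof p.407; Balaban1984PropagatorsII, Props. 2.2–2.7 pp.234–249 (the [B6] block, discharged by name)] -/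
theorem b9LeafX_Y9OfRecord_of_obligations (θ₃ : Stage3Params) (hadm : θ₃.toStage1Params.Admissible) (Mstar : ℕ) (ops : OpsY N θ₃ Mstar)
    (hGp_e : ∀ (x : MemberY θ₃.d₆ θ₃.ℓ₆ θ₃.hd' θ₃.hL' θ₃.b₀ θ₃.b₁ Mstar) (n : Fin 4) (lam : (geo9Y x).Loc) (y : (geo9Y x).Site),
      (ops x).Gp.e n (bg9Y (Matrix (Fin N) (Fin N) ℂ) (specialUnitaryUnits (Fin N)) x).one lam y ≤ (Node00.GpU x.toKIdx).e n lam y)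
    (hGp_h1 : ∀ (x : MemberY θ₃.d₆ θ₃.ℓ₆ θ₃.hd' θ₃.hL' θ₃.b₀ θ₃.b₁ Mstar) (lam : (geo9Y x).Loc) (b : ℝ) (ζ : (geo9Y x).Cut),
      (ops x).Gp.h1 (bg9Y (Matrix (Fin N) (Fin N) ℂ) (specialUnitaryUnits (Fin N)) x).one lam b ζ ≤ (Node00.GpU x.toKIdx).h1 lam b ζ)
    (hC : ∀ (x : MemberY θ₃.d₆ θ₃.ℓ₆ θ₃.hd' θ₃.hL' θ₃.b₀ θ₃.b₁ Mstar) (y y' : (geo9Y x).Site),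
      |(ops x).Cinv.ker (bg9Y (Matrix (Fin N) (Fin N) ℂ) (specialUnitaryUnits (Fin N)) x).one y y'| ≤ |(Node00.CinvU x.toKIdx).ker y y'|)
    (hGA_e : ∀ (x : MemberY θ₃.d₆ θ₃.ℓ₆ θ₃.hd' θ₃.hL' θ₃.b₀ θ₃.b₁ Mstar) (n : Fin 4) (lam : (geo9Y x).Loc) (y : (geo9Y x).Site),
      (ops x).GA.e n (bg9Y (Matrix (Fin N) (Fin N) ℂ) (specialUnitaryUnits (Fin N)) x).one lam y ≤ (Node00.GU x.toKIdx).e n lam y)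
    (hGA_h1 : ∀ (x : MemberY θ₃.d₆ θ₃.ℓ₆ θ₃.hd' θ₃.hL' θ₃.b₀ θ₃.b₁ Mstar) (lam : (geo9Y x).Loc) (b : ℝ) (ζ : (geo9Y x).Cut),
      (ops x).GA.h1 (bg9Y (Matrix (Fin N) (Fin N) ℂ) (specialUnitaryUnits (Fin N)) x).one lam b ζ ≤ (Node00.GU x.toKIdx).h1 lam b ζ)
    (hGA_e4 : ∀ (x : MemberY θ₃.d₆ θ₃.ℓ₆ θ₃.hd' θ₃.hL' θ₃.b₀ θ₃.b₁ Mstar) (lam : (geo9Y x).Loc) (y : (geo9Y x).Site),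
      (ops x).GA.e4 (bg9Y (Matrix (Fin N) (Fin N) ℂ) (specialUnitaryUnits (Fin N)) x).one lam y ≤ (Node00.GU x.toKIdx).e4 lam y)
    (hGA_h2 : ∀ (x : MemberY θ₃.d₆ θ₃.ℓ₆ θ₃.hd' θ₃.hL' θ₃.b₀ θ₃.b₁ Mstar) (lam : (geo9Y x).Loc) (b : ℝ) (ζ : (geo9Y x).Cut),
      (ops x).GA.h2 (bg9Y (Matrix (Fin N) (Fin N) ℂ) (specialUnitaryUnits (Fin N)) x).one lam b ζ ≤ (Node00.GU x.toKIdx).h2 lam b ζ)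
    (hGA_l2 : ∀ (x : MemberY θ₃.d₆ θ₃.ℓ₆ θ₃.hd' θ₃.hL' θ₃.b₀ θ₃.b₁ Mstar) (n : Fin 6) (lam : (geo9Y x).Loc) (hc : (geo9Y x).Cut),
      (ops x).GA.l2 n (bg9Y (Matrix (Fin N) (Fin N) ℂ) (specialUnitaryUnits (Fin N)) x).one lam hc ≤ (Node00.GU x.toKIdx).l2 n lam hc)
    (hE4 : ∀ (x : MemberY θ₃.d₆ θ₃.ℓ₆ θ₃.hd' θ₃.hL' θ₃.b₀ θ₃.b₁ Mstar) (lam : (geo9Y x).Loc), ¬ (lam.isRight = true) →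
      ∀ y, (ops x).GA.e4 (bg9Y (Matrix (Fin N) (Fin N) ℂ) (specialUnitaryUnits (Fin N)) x).one lam y ≤ 0)
    (hH2 : ∀ (x : MemberY θ₃.d₆ θ₃.ℓ₆ θ₃.hd' θ₃.hL' θ₃.b₀ θ₃.b₁ Mstar) (lam : (geo9Y x).Loc), ¬ (lam.isRight = true) →
      ∀ (β : ℝ) (ζ : (geo9Y x).Cut), (ops x).GA.h2 (bg9Y (Matrix (Fin N) (Fin N) ℂ) (specialUnitaryUnits (Fin N)) x).one lam β ζ ≤ 0)
    (hGp : B9FromB6.ResidualGpAtOne geo9Y (bg9Y (Matrix (Fin N) (Fin N) ℂ) (specialUnitaryUnits (Fin N))) (fun x => (ops x).Gp))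
    (hGA : B9FromB6.ResidualGAGlobAtOne geo9Y (bg9Y (Matrix (Fin N) (Fin N) ℂ) (specialUnitaryUnits (Fin N))) (fun x => (ops x).GA))
    (hB : B9.SectBStepPrinted (θ₃.d₆ + 1) c35Y geo9Y (bg9Y (Matrix (Fin N) (Fin N) ℂ) (specialUnitaryUnits (Fin N))) (fun x => (ops x).Gp)
      (fun x => (ops x).GA) (fun x => (ops x).Cinv) (fun x => (ops x).IsAnalyticExt))
    (hg : B9.GaugeReduction335 (θ₃.d₆ + 1) c35Y geo9Y (bg9Y (Matrix (Fin N) (Fin N) ℂ) (specialUnitaryUnits (Fin N))) InCubeY (fun x => (ops x).Gp)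
      (fun x => (ops x).GA) (fun x => (ops x).Cinv))
    (t37 : B9.Thm37Printed c35Y geo9Y (bg9Y (Matrix (Fin N) (Fin N) ℂ) (specialUnitaryUnits (Fin N))) (fun x => (ops x).E37))
    (c38 : B9.Cor38Printed c35Y geo9Y (bg9Y (Matrix (Fin N) (Fin N) ℂ) (specialUnitaryUnits (Fin N))) (fun x => (ops x).E37))
    (t39 : B9.Thm39Printed (θ₃.d₆ + 1) c35Y geo9Y (bg9Y (Matrix (Fin N) (Fin N) ℂ) (specialUnitaryUnits (Fin N))) (fun x => (ops x).EK39))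
    (t310 : B9.Thm310Printed c35Y geo9Y (bg9Y (Matrix (Fin N) (Fin N) ℂ) (specialUnitaryUnits (Fin N))) (fun x => (ops x).E310))
    (hsum : B9.RWSumsYieldIneqs geo9Y (bg9Y (Matrix (Fin N) (Fin N) ℂ) (specialUnitaryUnits (Fin N))) (fun x => (ops x).E37) (fun x => (ops x).E310)
      (fun x => (ops x).Gp) (fun x => (ops x).GA))
    (hksum : B9.RWKernelSumYields (θ₃.d₆ + 1) geo9Y (bg9Y (Matrix (Fin N) (Fin N) ℂ) (specialUnitaryUnits (Fin N))) (fun x => (ops x).EK39)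
      (fun x => (ops x).Cinv))
    (t311 : B9.Thm311Printed c35Y geo9Y (bg9Y (Matrix (Fin N) (Fin N) ℂ) (specialUnitaryUnits (Fin N))) (fun x => (ops x).PosDef))
    (t312 : B9.Thm312Printed (θ₃.d₆ + 1) c35Y geo9Y (bg9Y (Matrix (Fin N) (Fin N) ℂ) (specialUnitaryUnits (Fin N))) (fun x => (ops x).GD)
      (fun x => (ops x).G₁) (fun x => (ops x).H) (fun x => (ops x).H₁) (fun x => (ops x).HasRWExp) (fun x => (ops x).HasRWExpH)
      (fun x => (ops x).PosDefK))
    (t313 : B9.Thm313Printed c35Y geo9Y (bg9Y (Matrix (Fin N) (Fin N) ℂ) (specialUnitaryUnits (Fin N))) (fun x => (ops x).GG)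
      (fun x => (ops x).HasRWExp) (fun x => (ops x).PosDefK))
    (t314 : B9.Thm314Printed c35Y geo9Y (bg9Y (Matrix (Fin N) (Fin N) ℂ) (specialUnitaryUnits (Fin N))) (fun x => (ops x).Kdiff) dOmegaY)
    (t315 : B9.Thm315FullPrinted c35Y geo9Y (bg9Y (Matrix (Fin N) (Fin N) ℂ) (specialUnitaryUnits (Fin N))) (fun x => (ops x).Ck) inΛY unitDistY
      (fun x => (ops x).GivenBy3185) (fun x => (ops x).HasRWExpC))
    (s349 : B9.Stmt349Printed (θ₃.d₆ + 1) c35Y geo9Y (bg9Y (Matrix (Fin N) (Fin N) ℂ) (specialUnitaryUnits (Fin N))) (fun x => (ops x).P349))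
    (s3132 : B9.Stmt3132Printed (θ₃.d₆ + 1) c35Y geo9Y (bg9Y (Matrix (Fin N) (Fin N) ℂ) (specialUnitaryUnits (Fin N))) (fun x => (ops x).QGQinv)
      (fun x => (ops x).QG1Qinv))
    (t314loc : B9Thm314.Thm314LocalPrinted c35Y geo9Y (bg9Y (Matrix (Fin N) (Fin N) ℂ) (specialUnitaryUnits (Fin N))) (fun x => (ops x).Kdiff)
      OmKY dOmegaY) :
    B9LeafX (Y9OfRecord N θ₃ Mstar ops) :=
  B9PinCarriersKLevelV1.b9LeafX_carriersY ops θ₃.δ₀ _ _ hGp_e hGp_h1 hC hGA_e hGA_h1 hGA_e4 hGA_h2 hGA_l2 hE4 hH2 hGp hGA hB hg t37 c38 t39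
    t310 hsum hksum t311 t312 t313 t314 t315 s349 s3132 t314loc (b6BlockParam_D6OfRecord θ₃ hadm)

/-! ## §3 (W2) guards — why the ∀-form over ₉CB10Y is not a discharge target -/

section Guards

variable {F : T4Family}

/-- **A WORLD PRESENTED BY A GIVEN OPERATOR LAYER**: every admissible Stage-9 parameter with its provisos and a positive window, EVERY floor and EVERY operator layer
`ops` present a ₉CB10Y record `(datumOfRecord₉ θ h, w)` whose `b9` leaf IS `B9LeafX (Y9OfRecord N θ₃ M⋆ ops)` at every run (g29's `exists_world_isRecordOfRecord₉CB10Y`,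
rebuilt with the pin exposed). [cite: Balaban1985BackgroundPropagators, Thms 3.1–3.15 pp.397–432 (bookkeeping: the record's `b9` face)] -/
theorem exists_record₉CB10Y_leaf_iff (θ : Stage9Params F N) (h : θ.Provisos) (hθ : θ.Admissible) (hγ : 0 < θ.γ) (Mstar : ℕ)
    (ops : OpsY N θ.toStage3Params Mstar) :
    ∃ w : WorldP, IsRecordOfRecord₉CB10Y F N (datumOfRecord₉ F N θ h) w ∧
      ∀ P : B12.RunParams, ((leavesP w P).b9 ↔ B9LeafX (Y9OfRecord N θ.toStage3Params Mstar ops)) := by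
  obtain ⟨w₀, -, -⟩ := exists_world_isRecordOfRecord₉C F N θ h hθ ⟨hγ, le_rfl⟩
  refine ⟨{ w₀ with
      C := (datumOfRecord₉ F N θ h).C, γ := θ.γ, L := (θ.L : ℝ), one_lt_L := by exact_mod_cast θ.hL.2,
      up := fun P => upOfRecord₅C F N (((θ.toStage5 F N).pinB10 F N).pinY F N (Y9OfRecord N θ.toStage3Params Mstar ops)) P },
    isRecordOfRecord₉CB10Y_of_eq F N θ h hθ Mstar ops _ rfl ⟨hγ, le_rfl⟩ rfl (fun _ => rfl), fun P => ?_⟩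
  exact upOfRecord₅C_pinY_b9_iff F N _ _ P

/-- **THE ∀-FORM FORCES THE LEAF AT EVERY OPERATOR LAYER** (converse of `s_N06_record₉CB10Y_of_bundleSlot` up to the window clause): `S_N06 (₉CB10Y)` implies
`B9LeafX (Y9OfRecord N θ₃ M⋆ ops)` for EVERY admissible Stage-9 parameter `θ` with provisos and `γ > 0`, EVERY floor, EVERY operator layer — in particular at
layers whose data violate print.  This is WHY the ∀-form over ₉CB10Y is not an N06 target (plan rev-1: socket form). [cite: Balaban1985BackgroundPropagators, Thms 3.1–3.15 pp.397–432 (bookkeeping)] -/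
theorem b9LeafX_of_s_N06_record₉CB10Y (hS : S_N06 (fun F D w => IsRecordOfRecord₉CB10Y F N D w))
    (θ : Stage9Params F N) (h : θ.Provisos) (hθ : θ.Admissible) (hγ : 0 < θ.γ) (Mstar : ℕ) (ops : OpsY N θ.toStage3Params Mstar) :
    B9LeafX (Y9OfRecord N θ.toStage3Params Mstar ops) := by
  obtain ⟨w, hw, hiff⟩ := exists_record₉CB10Y_leaf_iff θ h hθ hγ Mstar ops
  let P₀ : B12.RunParams := ⟨0, 0, 0⟩
  exact (hiff P₀).1 ((b9_main_iff_leaf_of_isRecordOfRecord₉CB10Y hw P₀).1 (hS F _ w hw P₀))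

/-- **ONE BAD OPERATOR LAYER REFUTES THE ∀-FORM**: an operator layer (over an admissible Stage-9 parameter with provisos and `γ > 0`) at whose bundle of record
the extended leaf FAILS makes `S_N06 (₉CB10Y)` FALSE — the record predicate puts no law on `ops`. (Typed, not asserted: no bad layer is constructed here.)
[cite: Balaban1985BackgroundPropagators, Thms 3.1–3.15 pp.397–432 (bookkeeping)] -/
theorem not_s_N06_record₉CB10Y_of_badOps (θ : Stage9Params F N) (h : θ.Provisos) (hθ : θ.Admissible) (hγ : 0 < θ.γ) (Mstar : ℕ)
    (ops : OpsY N θ.toStage3Params Mstar) (hbad : ¬ B9LeafX (Y9OfRecord N θ.toStage3Params Mstar ops)) :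
    ¬ S_N06 (fun F D w => IsRecordOfRecord₉CB10Y F N D w) :=
  fun hS => hbad (b9LeafX_of_s_N06_record₉CB10Y hS θ h hθ hγ Mstar ops)

/-- **THE JUNK LAYER CLOSES THE LEAF AT THE BUNDLE OF RECORD** (def-Y's A5 certificate `B9PinCarriersNonVacuity.exists_ops_b9LeafX` at the record's data, the
[B6] block by N03's theorem of record): for every Stage-3 dictionary with admissible Stage-1 part and every floor there is an operator layer — the ZERO layer,
`Gp.e ≡ 0` — with `B9LeafX (Y9OfRecord N θ₃ M⋆ ops₀)`.  The vacuity source of any «N06 at ₉CB10Y» sentence, LOCATED.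
[cite: Balaban1985BackgroundPropagators, Thms 3.1–3.15 pp.397–432 (bookkeeping: junk satisfiability of the typed leaf)] -/
theorem exists_junkOps_b9LeafX_Y9OfRecord (θ₃ : Stage3Params) (hadm : θ₃.toStage1Params.Admissible) (Mstar : ℕ) :
    ∃ ops : OpsY N θ₃ Mstar,
      (∀ (x : MemberY θ₃.d₆ θ₃.ℓ₆ θ₃.hd' θ₃.hL' θ₃.b₀ θ₃.b₁ Mstar) (n : Fin 4)
          (U : (bg9Y (Matrix (Fin N) (Fin N) ℂ) (specialUnitaryUnits (Fin N)) x).Cfg) (lam : (geo9Y x).Loc) (y : (geo9Y x).Site),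
        (ops x).Gp.e n U lam y = 0) ∧
      B9LeafX (Y9OfRecord N θ₃ Mstar ops) :=
  B9PinCarriersNonVacuity.exists_ops_b9LeafX (Mstar := Mstar) (Matrix (Fin N) (Fin N) ℂ) (specialUnitaryUnits (Fin N)) θ₃.δ₀ _ _
    (b6BlockParam_D6OfRecord θ₃ hadm)

/-- **N06 HOLDS AT THE JUNK-PRESENTED RECORDS — INHABITED, NON-VACUOUS, CONTENT-FREE**: every admissible Stage-9 parameter with its provisos and `γ > 0`, every
floor, is presented (with the zero operator layer) by a ₉CB10Y record at which `Dag.B9_main` holds at EVERY run.  So a sentence «N06 holds at some ∕ these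
₉CB10Y records» certifies nothing about Bałaban's propagators (A6 located), and the ∀-form fails for bad layers (`not_s_N06_record₉CB10Y_of_badOps`): either way
NOT-A-DISCHARGE; the operator layer (XL) is the next pin. [cite: Balaban1985BackgroundPropagators, Thms 3.1–3.15 pp.397–432 (bookkeeping)] -/
theorem exists_record₉CB10Y_b9_main_junk (θ : Stage9Params F N) (h : θ.Provisos) (hθ : θ.Admissible) (hγ : 0 < θ.γ) (Mstar : ℕ) :
    ∃ (ops : OpsY N θ.toStage3Params Mstar) (w : WorldP),
      (∀ (x : MemberY θ.toStage3Params.d₆ θ.toStage3Params.ℓ₆ θ.toStage3Params.hd' θ.toStage3Params.hL' θ.toStage3Params.b₀ θ.toStage3Params.b₁ Mstar)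
          (n : Fin 4) (U : (bg9Y (Matrix (Fin N) (Fin N) ℂ) (specialUnitaryUnits (Fin N)) x).Cfg) (lam : (geo9Y x).Loc) (y : (geo9Y x).Site),
        (ops x).Gp.e n U lam y = 0) ∧
      IsRecordOfRecord₉CB10Y F N (datumOfRecord₉ F N θ h) w ∧ ∀ P : B12.RunParams, Dag.B9_main (leavesP w P) := by
  obtain ⟨ops, hzero, hleaf⟩ := exists_junkOps_b9LeafX_Y9OfRecord (N := N) θ.toStage3Params hθ.1.1.1.1 Mstar
  obtain ⟨w, hw, hiff⟩ := exists_record₉CB10Y_leaf_iff θ h hθ hγ Mstar ops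
  exact ⟨ops, w, hzero, hw, fun P => (b9_main_iff_leaf_of_isRecordOfRecord₉CB10Y hw P).2 ((hiff P).2 hleaf)⟩

/-- **R422 at node level**: a record predicate ADMITTING a world and a run at which `Dag.B9_main` fails has no `S_N06`. [bookkeeping] -/
theorem not_s_N06_of_admits (Rec : RecordPred N)
    (hex : ∃ (F : T4Family) (D : Datum F N) (w : WorldP) (P : B12.RunParams), Rec F D w ∧ ¬ Dag.B9_main (leavesP w P)) :
    ¬ S_N06 Rec := by
  rintro hS
  obtain ⟨F, D, w, P, hR, hnot⟩ := hex
  exact hnot (hS F D w hR P)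

/-- **Vacuity guard**: over a predicate with NO records `S_N06` holds for nothing — the ∀-form alone certifies no content (A1: INHABITED-AT-₉C = NODE 00's K0,
not claimed here). [bookkeeping] -/
theorem s_N06_of_empty (Rec : RecordPred N) (hempty : ∀ (F : T4Family) (D : Datum F N) (w : WorldP), ¬ Rec F D w) : S_N06 Rec :=
  fun F D w hR => (hempty F D w hR).elim

end Guards

end Summit.QuantumFields.YangMills.BalabanUVNodes.N06AtRecord9CB10Y

end
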